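import Mathlib
import Summits.HodgeConjecture.HodgeConjecture.Theorems.WeilClassTestFormatFiveThreeCrossPlusOne
import Summits.HodgeConjecture.HodgeConjecture.Theorems.WeilClassTestFormatFiveThreeCrossPlusOneReducedF
import Summits.HodgeConjecture.HodgeConjecture.Theorems.WeilClassTestFormatFiveThreeCrossPlusOneAggregatesF
import Summits.HodgeConjecture.HodgeConjecture.Theorems.WeilClassTestFormatFiveThreeCrossPlusOneGaugeF

/-!
# Conjecture N (hodge-weil ladder, GAPS G51b), format (5,3): CONJECTURE N ON CROSS + ONE FREE F-ROOT, WITH (P1)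

Prover 2, generation 22 (note `run/shared/lean/b2b/hodge-weil/b2b-hweil-pv2-g22/CROSSPLUS1-G22.md`, ADDENDUM F). Companion of
`WeilClassTestFormatFiveThreeCrossPlusOne` (free E-root): **`conjectureN_53_cross_plus_one_F`** — every centred pure format-(5,3) corner configuration
in which `E₁…E₅, F₂, F₃` lie on the cross and `F₁` is arbitrary has `Q₂ + Q₄ ≥ 0`. Chain: `G_gauge_cross_plus_one_F`, `…AggregatesF`, `Mo_corner`/`T_corner`
(from the E-file), `cauchy_schwarz_H_F/V_F`, `aggregate_cross_plus_one_F` ⟸ `reduced_cross_plus_one_F` ⟸ `pieceF`. Pure real algebra; nothing here is a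
case of HC, a rung or a door edge; no statement of Markman's papers is used; COUNT of record unchanged. New cell result ⇒ Summits/.
-/

set_option linter.dupNamespace false
set_option maxRecDepth 16384

namespace Summit.HodgeConjecture.HodgeConjecture.WeilClassTestFormatFiveThreeCrossPlusOneF

/-- AGGREGATE FORM (free F-root): from `2us = M − X`, `p₁, q₁ ≥ 0`, `X − p₁ ≥ 0`, `M − q₁ ≥ 0`, `P2 = P4 = 0`, `P4 − P1 = 0` in aggregate form and the
Cauchy–Schwarz inequalities `(D⁺ + p₁²)² ≤ (X − p₁)(C₃⁺ − p₁³)`, `(D⁻ + q₁²)² ≤ (M − q₁)(C₃⁻ − q₁³)` of the other roots, the gauge value of `G` is `≥ 0`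
(`…ReducedF.reduced_cross_plus_one_F` with `X1 = X − p₁`, `M1 = M − q₁`, `D1 = D⁺ + p₁²`, `E1 = D⁻ + q₁²`). -/
theorem aggregate_cross_plus_one_F (X M Dp Dm Cp Cm p₁ q₁ us : ℝ) (hus : 2 * us = M - X) (hp : 0 ≤ p₁) (hq : 0 ≤ q₁)
    (hX1 : 0 ≤ X - p₁) (hM1 : 0 ≤ M - q₁)
    (hP2 : Cm + Cp - 3*Dm*M/2 + Dm*X/2 + Dp*M/2 - 3*Dp*X/2 + M^3/2 - M^2*X/2 - M*X^2/2 - M*p₁*q₁ + X^3/2 - X*p₁*q₁ - p₁^2*q₁ - p₁*q₁^2 = 0)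
    (hP4 : -Cm + Cp + 3*Dm*M/2 - 3*Dm*X/2 + 3*Dp*M/2 - 3*Dp*X/2 - M^3/2 + 3*M^2*X/2 - 3*M*X^2/2 + 3*M*p₁*q₁ + X^3/2 - 3*X*p₁*q₁ - 3*p₁^2*q₁ + 3*p₁*q₁^2 = 0)
    (hK : -2*Dm*X + 2*Dp*M + 2*M^2*X - 2*M*X^2 + 4*M*p₁*q₁ - 4*X*p₁*q₁ - 4*p₁^2*q₁ + 4*p₁*q₁^2 = 0)
    (hCSp : (Dp + p₁ ^ 2) ^ 2 ≤ (X - p₁) * (Cp - p₁ ^ 3)) (hCSm : (Dm + q₁ ^ 2) ^ 2 ≤ (M - q₁) * (Cm - q₁ ^ 3)) :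
    0 ≤ (us * (X + M) + (Dp - Dm)) ^ 2 + ((Dm + Dp - M^2/2 + M*X - X^2/2 + 2*p₁*q₁) / 2) * (X + M) ^ 2 - (Dm + Dp - M^2/2 + M*X - X^2/2 + 2*p₁*q₁) ^ 2 - 2 * (Dm + Dp - M^2/2 + M*X - X^2/2 + 2*p₁*q₁) * us ^ 2
        + 4 * (p₁ * q₁) * (3 * ((us + q₁ - p₁) ^ 2 - (Dm + Dp - M^2/2 + M*X - X^2/2 + 2*p₁*q₁) / 2) + (Dm + Dp - M^2/2 + M*X - X^2/2 + 2*p₁*q₁)) := by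
  have hus' : us = (M - X) / 2 := by linarith
  subst hus'
  have hKr : 2*(Dp + p₁^2)*(M - q₁) + 2*(Dp + p₁^2)*q₁ - 2*(Dm + q₁^2)*(X - p₁) - 2*(Dm + q₁^2)*p₁ + 2*(M - q₁)^2*(X - p₁) + 2*(M - q₁)^2*p₁ - 2*(M - q₁)*(X - p₁)^2 - 4*(M - q₁)*(X - p₁)*p₁ + 4*(M - q₁)*(X - p₁)*q₁ - 4*(M - q₁)*p₁^2 + 8*(M - q₁)*p₁*q₁ - 2*(X - p₁)^2*q₁ - 8*(X - p₁)*p₁*q₁ + 4*(X - p₁)*q₁^2 - 12*p₁^2*q₁ + 12*p₁*q₁^2 = 0 := by linear_combination hK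
  have hpr : 0 ≤ (X - p₁) * ((-2*(Dp + p₁^2)*(M - q₁) + 3*(Dp + p₁^2)*(X - p₁) + 3*(Dp + p₁^2)*p₁ - 2*(Dp + p₁^2)*q₁ + (Dm + q₁^2)*(X - p₁) + (Dm + q₁^2)*p₁ - (M - q₁)^2*(X - p₁) - (M - q₁)^2*p₁ + 2*(M - q₁)*(X - p₁)^2 + 4*(M - q₁)*(X - p₁)*p₁ - 2*(M - q₁)*(X - p₁)*q₁ + 4*(M - q₁)*p₁^2 - 4*(M - q₁)*p₁*q₁ - (X - p₁)^3 - 3*(X - p₁)^2*p₁ + 2*(X - p₁)^2*q₁ - 6*(X - p₁)*p₁^2 + 8*(X - p₁)*p₁*q₁ - 2*(X - p₁)*q₁^2 - 6*p₁^3 + 12*p₁^2*q₁ - 6*p₁*q₁^2) / 2) - (Dp + p₁^2)^2 := by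
    have e : (X - p₁) * ((-2*(Dp + p₁^2)*(M - q₁) + 3*(Dp + p₁^2)*(X - p₁) + 3*(Dp + p₁^2)*p₁ - 2*(Dp + p₁^2)*q₁ + (Dm + q₁^2)*(X - p₁) + (Dm + q₁^2)*p₁ - (M - q₁)^2*(X - p₁) - (M - q₁)^2*p₁ + 2*(M - q₁)*(X - p₁)^2 + 4*(M - q₁)*(X - p₁)*p₁ - 2*(M - q₁)*(X - p₁)*q₁ + 4*(M - q₁)*p₁^2 - 4*(M - q₁)*p₁*q₁ - (X - p₁)^3 - 3*(X - p₁)^2*p₁ + 2*(X - p₁)^2*q₁ - 6*(X - p₁)*p₁^2 + 8*(X - p₁)*p₁*q₁ - 2*(X - p₁)*q₁^2 - 6*p₁^3 + 12*p₁^2*q₁ - 6*p₁*q₁^2) / 2) - (Dp + p₁^2)^2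
        = ((X - p₁) * (Cp - p₁ ^ 3) - (Dp + p₁ ^ 2) ^ 2) - (X - p₁) / 2 * (Cm + Cp - 3*Dm*M/2 + Dm*X/2 + Dp*M/2 - 3*Dp*X/2 + M^3/2 - M^2*X/2 - M*X^2/2 - M*p₁*q₁ + X^3/2 - X*p₁*q₁ - p₁^2*q₁ - p₁*q₁^2) - (X - p₁) / 2 * (-Cm + Cp + 3*Dm*M/2 - 3*Dm*X/2 + 3*Dp*M/2 - 3*Dp*X/2 - M^3/2 + 3*M^2*X/2 - 3*M*X^2/2 + 3*M*p₁*q₁ + X^3/2 - 3*X*p₁*q₁ - 3*p₁^2*q₁ + 3*p₁*q₁^2) := by ring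
    rw [e, hP2, hP4]; linarith
  have hmr : 0 ≤ (M - q₁) * (((Dp + p₁^2)*(M - q₁) + (Dp + p₁^2)*q₁ + 3*(Dm + q₁^2)*(M - q₁) - 2*(Dm + q₁^2)*(X - p₁) - 2*(Dm + q₁^2)*p₁ + 3*(Dm + q₁^2)*q₁ - (M - q₁)^3 + 2*(M - q₁)^2*(X - p₁) + 2*(M - q₁)^2*p₁ - 3*(M - q₁)^2*q₁ - (M - q₁)*(X - p₁)^2 - 2*(M - q₁)*(X - p₁)*p₁ + 4*(M - q₁)*(X - p₁)*q₁ - 2*(M - q₁)*p₁^2 + 8*(M - q₁)*p₁*q₁ - 6*(M - q₁)*q₁^2 - (X - p₁)^2*q₁ - 4*(X - p₁)*p₁*q₁ + 4*(X - p₁)*q₁^2 - 6*p₁^2*q₁ + 12*p₁*q₁^2 - 6*q₁^3) / 2) - (Dm + q₁^2)^2 := by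
    have e : (M - q₁) * (((Dp + p₁^2)*(M - q₁) + (Dp + p₁^2)*q₁ + 3*(Dm + q₁^2)*(M - q₁) - 2*(Dm + q₁^2)*(X - p₁) - 2*(Dm + q₁^2)*p₁ + 3*(Dm + q₁^2)*q₁ - (M - q₁)^3 + 2*(M - q₁)^2*(X - p₁) + 2*(M - q₁)^2*p₁ - 3*(M - q₁)^2*q₁ - (M - q₁)*(X - p₁)^2 - 2*(M - q₁)*(X - p₁)*p₁ + 4*(M - q₁)*(X - p₁)*q₁ - 2*(M - q₁)*p₁^2 + 8*(M - q₁)*p₁*q₁ - 6*(M - q₁)*q₁^2 - (X - p₁)^2*q₁ - 4*(X - p₁)*p₁*q₁ + 4*(X - p₁)*q₁^2 - 6*p₁^2*q₁ + 12*p₁*q₁^2 - 6*q₁^3) / 2) - (Dm + q₁^2)^2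
        = ((M - q₁) * (Cm - q₁ ^ 3) - (Dm + q₁ ^ 2) ^ 2) - (M - q₁) / 2 * (Cm + Cp - 3*Dm*M/2 + Dm*X/2 + Dp*M/2 - 3*Dp*X/2 + M^3/2 - M^2*X/2 - M*X^2/2 - M*p₁*q₁ + X^3/2 - X*p₁*q₁ - p₁^2*q₁ - p₁*q₁^2) + (M - q₁) / 2 * (-Cm + Cp + 3*Dm*M/2 - 3*Dm*X/2 + 3*Dp*M/2 - 3*Dp*X/2 - M^3/2 + 3*M^2*X/2 - 3*M*X^2/2 + 3*M*p₁*q₁ + X^3/2 - 3*X*p₁*q₁ - 3*p₁^2*q₁ + 3*p₁*q₁^2) := by ring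
    rw [e, hP2, hP4]; linarith
  have key := Summit.HodgeConjecture.HodgeConjecture.WeilClassTestFormatFiveThreeCrossPlusOneReducedF.reduced_cross_plus_one_F (X - p₁) (M - q₁) p₁ q₁ (Dp + p₁^2) (Dm + q₁^2) hX1 hM1 hp hq hKr hpr hmr
  have e2 : (((M - X) / 2) * (X + M) + (Dp - Dm)) ^ 2 + ((Dm + Dp - M^2/2 + M*X - X^2/2 + 2*p₁*q₁) / 2) * (X + M) ^ 2 - (Dm + Dp - M^2/2 + M*X - X^2/2 + 2*p₁*q₁) ^ 2 - 2 * (Dm + Dp - M^2/2 + M*X - X^2/2 + 2*p₁*q₁) * ((M - X) / 2) ^ 2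
        + 4 * (p₁ * q₁) * (3 * ((((M - X) / 2) + q₁ - p₁) ^ 2 - (Dm + Dp - M^2/2 + M*X - X^2/2 + 2*p₁*q₁) / 2) + (Dm + Dp - M^2/2 + M*X - X^2/2 + 2*p₁*q₁))
      = -4*(Dp + p₁^2)*(Dm + q₁^2) + 2*(Dp + p₁^2)*(M - q₁)^2 + 4*(Dp + p₁^2)*(M - q₁)*q₁ - 6*(Dp + p₁^2)*p₁*q₁ + 6*(Dp + p₁^2)*q₁^2 + 2*(Dm + q₁^2)*(X - p₁)^2 + 4*(Dm + q₁^2)*(X - p₁)*p₁ + 6*(Dm + q₁^2)*p₁^2 - 6*(Dm + q₁^2)*p₁*q₁ - 2*(M - q₁)^2*p₁^2 + 6*(M - q₁)^2*p₁*q₁ - 8*(M - q₁)*(X - p₁)*p₁*q₁ - 24*(M - q₁)*p₁^2*q₁ + 24*(M - q₁)*p₁*q₁^2 + 6*(X - p₁)^2*p₁*q₁ - 2*(X - p₁)^2*q₁^2 + 24*(X - p₁)*p₁^2*q₁ - 24*(X - p₁)*p₁*q₁^2 + 36*p₁^3*q₁ - 72*p₁^2*q₁^2 + 36*p₁*q₁^3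 := by ring
  rw [e2]; exact key

/-- Cauchy–Schwarz for the H-axis corner measure of the roots other than F₁. -/
theorem cauchy_schwarz_H_F (x₁ x₂ x₃ x₄ x₅ p₁ p₂ p₃ : ℝ) (hx₁ : 0 ≤ x₁) (hx₂ : 0 ≤ x₂) (hx₃ : 0 ≤ x₃) (hx₄ : 0 ≤ x₄) (hx₅ : 0 ≤ x₅) (hp₂ : 0 ≤ p₂) (hp₃ : 0 ≤ p₃) :
    (((x₁ ^ 2 + x₂ ^ 2 + x₃ ^ 2 + x₄ ^ 2 + x₅ ^ 2) - (p₁ ^ 2 + p₂ ^ 2 + p₃ ^ 2)) + p₁ ^ 2) ^ 2 ≤ ((x₁ + x₂ + x₃ + x₄ + x₅ + p₁ + p₂ + p₃) - p₁) * (((x₁ ^ 3 + x₂ ^ 3 + x₃ ^ 3 + x₄ ^ 3 + x₅ ^ 3) + (p₁ ^ 3 + p₂ ^ 3 + p₃ ^ 3)) - p₁ ^ 3) := by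
  have e : ((x₁ + x₂ + x₃ + x₄ + x₅ + p₁ + p₂ + p₃) - p₁) * (((x₁ ^ 3 + x₂ ^ 3 + x₃ ^ 3 + x₄ ^ 3 + x₅ ^ 3) + (p₁ ^ 3 + p₂ ^ 3 + p₃ ^ 3)) - p₁ ^ 3) - (((x₁ ^ 2 + x₂ ^ 2 + x₃ ^ 2 + x₄ ^ 2 + x₅ ^ 2) - (p₁ ^ 2 + p₂ ^ 2 + p₃ ^ 2)) + p₁ ^ 2) ^ 2
      = x₁ * x₂ * (x₁ - x₂) ^ 2 + x₁ * x₃ * (x₁ - x₃) ^ 2 + x₁ * x₄ * (x₁ - x₄) ^ 2 + x₁ * x₅ * (x₁ - x₅) ^ 2 + x₁ * p₂ * (x₁ - (-p₂)) ^ 2 + x₁ * p₃ * (x₁ - (-p₃)) ^ 2 + x₂ * x₃ * (x₂ - x₃) ^ 2 + x₂ * x₄ * (x₂ - x₄) ^ 2 + x₂ * x₅ * (x₂ - x₅) ^ 2 + x₂ * p₂ * (x₂ - (-p₂)) ^ 2 + x₂ * p₃ * (x₂ - (-p₃)) ^ 2 + x₃ * x₄ * (x₃ - x₄) ^ 2 +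 x₃ * x₅ * (x₃ - x₅) ^ 2 + x₃ * p₂ * (x₃ - (-p₂)) ^ 2 + x₃ * p₃ * (x₃ - (-p₃)) ^ 2 + x₄ * x₅ * (x₄ - x₅) ^ 2 + x₄ * p₂ * (x₄ - (-p₂)) ^ 2 + x₄ * p₃ * (x₄ - (-p₃)) ^ 2 + x₅ * p₂ * (x₅ - (-p₂)) ^ 2 + x₅ * p₃ * (x₅ - (-p₃)) ^ 2 + p₂ * p₃ * ((-p₂) - (-p₃)) ^ 2 := by ring
  have h : 0 ≤ x₁ * x₂ * (x₁ - x₂) ^ 2 + x₁ * x₃ * (x₁ - x₃) ^ 2 + x₁ * x₄ * (x₁ - x₄) ^ 2 + x₁ * x₅ * (x₁ - x₅) ^ 2 + x₁ * p₂ * (x₁ - (-p₂)) ^ 2 + x₁ * p₃ * (x₁ - (-p₃)) ^ 2 + x₂ * x₃ * (x₂ - x₃) ^ 2 + x₂ * x₄ * (x₂ - x₄) ^ 2 + x₂ * x₅ * (x₂ - x₅) ^ 2 + x₂ * p₂ * (x₂ - (-p₂)) ^ 2 + x₂ * p₃ * (x₂ - (-p₃)) ^ 2 + x₃ * x₄ *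 (x₃ - x₄) ^ 2 + x₃ * x₅ * (x₃ - x₅) ^ 2 + x₃ * p₂ * (x₃ - (-p₂)) ^ 2 + x₃ * p₃ * (x₃ - (-p₃)) ^ 2 + x₄ * x₅ * (x₄ - x₅) ^ 2 + x₄ * p₂ * (x₄ - (-p₂)) ^ 2 + x₄ * p₃ * (x₄ - (-p₃)) ^ 2 + x₅ * p₂ * (x₅ - (-p₂)) ^ 2 + x₅ * p₃ * (x₅ - (-p₃)) ^ 2 + p₂ * p₃ * ((-p₂) - (-p₃)) ^ 2 := by positivity
  linarith

/-- Cauchy–Schwarz for the V-axis corner measure of the roots other than F₁. -/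
theorem cauchy_schwarz_V_F (y₁ y₂ y₃ y₄ y₅ q₁ q₂ q₃ : ℝ) (hy₁ : 0 ≤ y₁) (hy₂ : 0 ≤ y₂) (hy₃ : 0 ≤ y₃) (hy₄ : 0 ≤ y₄) (hy₅ : 0 ≤ y₅) (hq₂ : 0 ≤ q₂) (hq₃ : 0 ≤ q₃) :
    (((y₁ ^ 2 + y₂ ^ 2 + y₃ ^ 2 + y₄ ^ 2 + y₅ ^ 2) - (q₁ ^ 2 + q₂ ^ 2 + q₃ ^ 2)) + q₁ ^ 2) ^ 2 ≤ ((y₁ + y₂ + y₃ + y₄ + y₅ + q₁ + q₂ + q₃) - q₁) * (((y₁ ^ 3 + y₂ ^ 3 + y₃ ^ 3 + y₄ ^ 3 + y₅ ^ 3) + (q₁ ^ 3 + q₂ ^ 3 + q₃ ^ 3)) - q₁ ^ 3) := by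
  have e : ((y₁ + y₂ + y₃ + y₄ + y₅ + q₁ + q₂ + q₃) - q₁) * (((y₁ ^ 3 + y₂ ^ 3 + y₃ ^ 3 + y₄ ^ 3 + y₅ ^ 3) + (q₁ ^ 3 + q₂ ^ 3 + q₃ ^ 3)) - q₁ ^ 3) - (((y₁ ^ 2 + y₂ ^ 2 + y₃ ^ 2 + y₄ ^ 2 + y₅ ^ 2) - (q₁ ^ 2 + q₂ ^ 2 + q₃ ^ 2)) + q₁ ^ 2) ^ 2
      = y₁ * y₂ * (y₁ - y₂) ^ 2 + y₁ * y₃ * (y₁ - y₃) ^ 2 + y₁ * y₄ * (y₁ - y₄) ^ 2 + y₁ * y₅ * (y₁ - y₅) ^ 2 + y₁ * q₂ * (y₁ - (-q₂)) ^ 2 + y₁ * q₃ * (y₁ - (-q₃)) ^ 2 + y₂ * y₃ * (y₂ - y₃) ^ 2 + y₂ * y₄ * (y₂ - y₄) ^ 2 + y₂ * y₅ * (y₂ - y₅) ^ 2 + y₂ * q₂ * (y₂ - (-q₂)) ^ 2 + y₂ * q₃ * (y₂ - (-q₃)) ^ 2 + y₃ * y₄ * (y₃ - y₄) ^ 2 +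 y₃ * y₅ * (y₃ - y₅) ^ 2 + y₃ * q₂ * (y₃ - (-q₂)) ^ 2 + y₃ * q₃ * (y₃ - (-q₃)) ^ 2 + y₄ * y₅ * (y₄ - y₅) ^ 2 + y₄ * q₂ * (y₄ - (-q₂)) ^ 2 + y₄ * q₃ * (y₄ - (-q₃)) ^ 2 + y₅ * q₂ * (y₅ - (-q₂)) ^ 2 + y₅ * q₃ * (y₅ - (-q₃)) ^ 2 + q₂ * q₃ * ((-q₂) - (-q₃)) ^ 2 := by ring
  have h : 0 ≤ y₁ * y₂ * (y₁ - y₂) ^ 2 + y₁ * y₃ * (y₁ - y₃) ^ 2 + y₁ * y₄ * (y₁ - y₄) ^ 2 + y₁ * y₅ * (y₁ - y₅) ^ 2 + y₁ * q₂ * (y₁ - (-q₂)) ^ 2 + y₁ * q₃ * (y₁ - (-q₃)) ^ 2 + y₂ * y₃ * (y₂ - y₃) ^ 2 + y₂ * y₄ * (y₂ - y₄) ^ 2 + y₂ * y₅ * (y₂ - y₅) ^ 2 + y₂ * q₂ * (y₂ - (-q₂)) ^ 2 + y₂ * q₃ * (y₂ - (-q₃)) ^ 2 + y₃ * y₄ *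 (y₃ - y₄) ^ 2 + y₃ * y₅ * (y₃ - y₅) ^ 2 + y₃ * q₂ * (y₃ - (-q₂)) ^ 2 + y₃ * q₃ * (y₃ - (-q₃)) ^ 2 + y₄ * y₅ * (y₄ - y₅) ^ 2 + y₄ * q₂ * (y₄ - (-q₂)) ^ 2 + y₄ * q₃ * (y₄ - (-q₃)) ^ 2 + y₅ * q₂ * (y₅ - (-q₂)) ^ 2 + y₅ * q₃ * (y₅ - (-q₃)) ^ 2 + q₂ * q₃ * ((-q₂) - (-q₃)) ^ 2 := by positivity
  linarith

set_option maxHeartbeats 4000000 in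
/-- **CONJECTURE N ON 'CROSS + ONE FREE F-ROOT' CONFIGURATIONS (format (5,3)), WITH (P1).** As `…CrossPlusOne.conjectureN_53_cross_plus_one`, but the
root off the cross is the F-root `F₁` (`E₁,…,E₅, F₂, F₃` on the two null lines). Together the two theorems cover every pure centred corner configuration
with at most one root off the cross. -/
theorem conjectureN_53_cross_plus_one_F (A₁ A₂ A₃ A₄ A₅ B₁ B₂ B₃ u₁ u₂ u₃ u₄ u₅ v₁ v₂ v₃ As us : ℝ) (x₁ x₂ x₃ x₄ x₅ y₁ y₂ y₃ y₄ y₅ p₁ p₂ p₃ q₁ q₂ q₃ : ℝ)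
    (hA : A₁ + A₂ + A₃ + A₄ + A₅ = B₁ + B₂ + B₃) (hC : u₁ + u₂ + u₃ + u₄ + u₅ = v₁ + v₂ + v₃)
    (hP2 : ((A₁ * u₁ ^ 2 + A₂ * u₂ ^ 2 + A₃ * u₃ ^ 2 + A₄ * u₄ ^ 2 + A₅ * u₅ ^ 2) - (B₁ * v₁ ^ 2 + B₂ * v₂ ^ 2 + B₃ * v₃ ^ 2)) = 0)
    (hP4 : ((u₁ ^ 3 + u₂ ^ 3 + u₃ ^ 3 + u₄ ^ 3 + u₅ ^ 3) - (v₁ ^ 3 + v₂ ^ 3 + v₃ ^ 3)) = 0)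
    (hP1 : ((A₁ ^ 2 * u₁ + A₂ ^ 2 * u₂ + A₃ ^ 2 * u₃ + A₄ ^ 2 * u₄ + A₅ ^ 2 * u₅) - (B₁ ^ 2 * v₁ + B₂ ^ 2 * v₂ + B₃ ^ 2 * v₃)) = 0)
    (hA₁ : A₁ = As + x₁ + y₁) (hA₂ : A₂ = As + x₂ + y₂) (hA₃ : A₃ = As + x₃ + y₃) (hA₄ : A₄ = As + x₄ + y₄) (hA₅ : A₅ = As + x₅ + y₅) (hu₁ : u₁ = us + x₁ - y₁) (hu₂ : u₂ = us + x₂ - y₂) (hu₃ : u₃ = us + x₃ - y₃) (hu₄ : u₄ = us + x₄ - y₄) (hu₅ : u₅ = us + x₅ - y₅) (hB₁ : B₁ = As - p₁ - q₁) (hB₂ : B₂ = As - p₂ - q₂) (hB₃ : B₃ = As - p₃ - q₃) (hv₁ : v₁ = us + q₁ - p₁) (hv₂ : v₂ = us + q₂ - p₂) (hv₃ : v₃ = us + q₃ - p₃)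
    (hx₁ : 0 ≤ x₁) (hx₂ : 0 ≤ x₂) (hx₃ : 0 ≤ x₃) (hx₄ : 0 ≤ x₄) (hx₅ : 0 ≤ x₅) (hy₁ : 0 ≤ y₁) (hy₂ : 0 ≤ y₂) (hy₃ : 0 ≤ y₃) (hy₄ : 0 ≤ y₄) (hy₅ : 0 ≤ y₅) (hp₁ : 0 ≤ p₁) (hp₂ : 0 ≤ p₂) (hp₃ : 0 ≤ p₃) (hq₁ : 0 ≤ q₁) (hq₂ : 0 ≤ q₂) (hq₃ : 0 ≤ q₃)
    (hxy₁ : x₁ * y₁ = 0) (hxy₂ : x₂ * y₂ = 0) (hxy₃ : x₃ * y₃ = 0) (hxy₄ : x₄ * y₄ = 0) (hxy₅ : x₅ * y₅ = 0) (hpq₂ : p₂ * q₂ = 0) (hpq₃ : p₃ * q₃ = 0) :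
    0 ≤ (1 / 2) * ((A₁ ^ 2 + A₂ ^ 2 + A₃ ^ 2 + A₄ ^ 2 + A₅ ^ 2) - (B₁ ^ 2 + B₂ ^ 2 + B₃ ^ 2)) * ((u₁ ^ 2 + u₂ ^ 2 + u₃ ^ 2 + u₄ ^ 2 + u₅ ^ 2) - (v₁ ^ 2 + v₂ ^ 2 + v₃ ^ 2))
        + ((A₁ * u₁ + A₂ * u₂ + A₃ * u₃ + A₄ * u₄ + A₅ * u₅) - (B₁ * v₁ + B₂ * v₂ + B₃ * v₃)) ^ 2
        - 3 * ((A₁ ^ 2 * u₁ ^ 2 + A₂ ^ 2 * u₂ ^ 2 + A₃ ^ 2 * u₃ ^ 2 + A₄ ^ 2 * u₄ ^ 2 + A₅ ^ 2 * u₅ ^ 2) - (B₁ ^ 2 * v₁ ^ 2 + B₂ ^ 2 * v₂ ^ 2 + B₃ ^ 2 * v₃ ^ 2))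
      + (3 * ((u₁ ^ 4 + u₂ ^ 4 + u₃ ^ 4 + u₄ ^ 4 + u₅ ^ 4) - (v₁ ^ 4 + v₂ ^ 4 + v₃ ^ 4)) - (3 / 2) * ((u₁ ^ 2 + u₂ ^ 2 + u₃ ^ 2 + u₄ ^ 2 + u₅ ^ 2) - (v₁ ^ 2 + v₂ ^ 2 + v₃ ^ 2)) ^ 2) := by
  have hG := Summit.HodgeConjecture.HodgeConjecture.WeilClassTestFormatFiveThreeCrossPlusOneGaugeF.G_gauge_cross_plus_one_F A₁ A₂ A₃ A₄ A₅ B₁ B₂ B₃ u₁ u₂ u₃ u₄ u₅ v₁ v₂ v₃ As us (p₁ * q₁) hA hC hP2 hP4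
    (by rw [hA₁, hu₁]; linear_combination 4 * hxy₁) (by rw [hA₂, hu₂]; linear_combination 4 * hxy₂) (by rw [hA₃, hu₃]; linear_combination 4 * hxy₃) (by rw [hA₄, hu₄]; linear_combination 4 * hxy₄) (by rw [hA₅, hu₅]; linear_combination 4 * hxy₅) (by rw [hB₁, hv₁]; ring) (by rw [hB₂, hv₂]; linear_combination 4 * hpq₂) (by rw [hB₃, hv₃]; linear_combination 4 * hpq₃)
  rw [hG]
  have hus : 2 * us = (y₁ + y₂ + y₃ + y₄ + y₅ + q₁ + q₂ + q₃) - (x₁ + x₂ + x₃ + x₄ + x₅ + p₁ + p₂ + p₃) := by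
    have h := hC
    rw [hu₁, hu₂, hu₃, hu₄, hu₅, hv₁, hv₂, hv₃] at h
    linarith
  have hAs : 2 * As = -((x₁ + x₂ + x₃ + x₄ + x₅ + p₁ + p₂ + p₃) + (y₁ + y₂ + y₃ + y₄ + y₅ + q₁ + q₂ + q₃)) := by
    have h := hA
    rw [hA₁, hA₂, hA₃, hA₄, hA₅, hB₁, hB₂, hB₃] at h
    linarith
  subst hA₁ hA₂ hA₃ hA₄ hA₅ hu₁ hu₂ hu₃ hu₄ hu₅ hB₁ hB₂ hB₃ hv₁ hv₂ hv₃
  rw [Summit.HodgeConjecture.HodgeConjecture.WeilClassTestFormatFiveThreeCrossPlusOne.Mo_corner, Summit.HodgeConjecture.HodgeConjecture.WeilClassTestFormatFiveThreeCrossPlusOne.T_corner, Summit.HodgeConjecture.HodgeConjecture.WeilClassTestFormatFiveThreeCrossPlusOneAggregatesF.S_on_cross_plus_one_F x₁ x₂ x₃ x₄ x₅ y₁ y₂ y₃ y₄ y₅ p₁ p₂ p₃ q₁ q₂ q₃ us As hus hAs hxy₁ hxy₂ hxy₃ hxy₄ hxy₅ hpq₂ hpq₃]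
  have hP2a := (Summit.HodgeConjecture.HodgeConjecture.WeilClassTestFormatFiveThreeCrossPlusOneAggregatesF.P2_on_cross_plus_one_F x₁ x₂ x₃ x₄ x₅ y₁ y₂ y₃ y₄ y₅ p₁ p₂ p₃ q₁ q₂ q₃ us As hus hAs hxy₁ hxy₂ hxy₃ hxy₄ hxy₅ hpq₂ hpq₃).symm.trans hP2
  have hP4a := (Summit.HodgeConjecture.HodgeConjecture.WeilClassTestFormatFiveThreeCrossPlusOneAggregatesF.P4_on_cross_plus_one_F x₁ x₂ x₃ x₄ x₅ y₁ y₂ y₃ y₄ y₅ p₁ p₂ p₃ q₁ q₂ q₃ us As hus hAs hxy₁ hxy₂ hxy₃ hxy₄ hxy₅ hpq₂ hpq₃).symm.trans hP4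
  have hKa : -2*((y₁ ^ 2 + y₂ ^ 2 + y₃ ^ 2 + y₄ ^ 2 + y₅ ^ 2) - (q₁ ^ 2 + q₂ ^ 2 + q₃ ^ 2))*(x₁ + x₂ + x₃ + x₄ + x₅ + p₁ + p₂ + p₃) + 2*((x₁ ^ 2 + x₂ ^ 2 + x₃ ^ 2 + x₄ ^ 2 + x₅ ^ 2) - (p₁ ^ 2 + p₂ ^ 2 + p₃ ^ 2))*(y₁ + y₂ + y₃ + y₄ + y₅ + q₁ + q₂ + q₃) + 2*(y₁ + y₂ + y₃ + y₄ + y₅ + q₁ + q₂ + q₃)^2*(x₁ + x₂ + x₃ + x₄ + x₅ + p₁ + p₂ + p₃) - 2*(y₁ + y₂ + y₃ + y₄ + y₅ + q₁ + q₂ + q₃)*(x₁ + x₂ + x₃ + x₄ + x₅ + p₁ + p₂ + p₃)^2 + 4*(y₁ + y₂ + y₃ + y₄ + y₅ + q₁ + q₂ + q₃)*p₁*q₁ - 4*(x₁ + x₂ + x₃ + x₄ + x₅ + p₁ + p₂ + p₃)*p₁*q₁ - 4*p₁^2*q₁ + 4*p₁*q₁^2 = 0 := by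
    rw [← Summit.HodgeConjecture.HodgeConjecture.WeilClassTestFormatFiveThreeCrossPlusOneAggregatesF.K_on_cross_plus_one_F x₁ x₂ x₃ x₄ x₅ y₁ y₂ y₃ y₄ y₅ p₁ p₂ p₃ q₁ q₂ q₃ us As hus hAs hxy₁ hxy₂ hxy₃ hxy₄ hxy₅ hpq₂ hpq₃, hP4, hP1]; norm_num
  have hX1 : 0 ≤ (x₁ + x₂ + x₃ + x₄ + x₅ + p₁ + p₂ + p₃) - p₁ := by linarith
  have hM1 : 0 ≤ (y₁ + y₂ + y₃ + y₄ + y₅ + q₁ + q₂ + q₃) - q₁ := by linarith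
  exact aggregate_cross_plus_one_F (x₁ + x₂ + x₃ + x₄ + x₅ + p₁ + p₂ + p₃) (y₁ + y₂ + y₃ + y₄ + y₅ + q₁ + q₂ + q₃) ((x₁ ^ 2 + x₂ ^ 2 + x₃ ^ 2 + x₄ ^ 2 + x₅ ^ 2) - (p₁ ^ 2 + p₂ ^ 2 + p₃ ^ 2)) ((y₁ ^ 2 + y₂ ^ 2 + y₃ ^ 2 + y₄ ^ 2 + y₅ ^ 2) - (q₁ ^ 2 + q₂ ^ 2 + q₃ ^ 2)) ((x₁ ^ 3 + x₂ ^ 3 + x₃ ^ 3 + x₄ ^ 3 + x₅ ^ 3) + (p₁ ^ 3 + p₂ ^ 3 + p₃ ^ 3)) ((y₁ ^ 3 + y₂ ^ 3 + y₃ ^ 3 + y₄ ^ 3 + y₅ ^ 3) + (q₁ ^ 3 + q₂ ^ 3 + q₃ ^ 3)) p₁ q₁ us hus hp₁ hq₁ hX1 hM1 hP2a hP4a hKa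
    (cauchy_schwarz_H_F x₁ x₂ x₃ x₄ x₅ p₁ p₂ p₃ hx₁ hx₂ hx₃ hx₄ hx₅ hp₂ hp₃) (cauchy_schwarz_V_F y₁ y₂ y₃ y₄ y₅ q₁ q₂ q₃ hy₁ hy₂ hy₃ hy₄ hy₅ hq₂ hq₃)

end Summit.HodgeConjecture.HodgeConjecture.WeilClassTestFormatFiveThreeCrossPlusOneF
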